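import Summits.BirchSwinnertonDyer.BirchSwinnertonDyer.Theorems.PrintCf2SplitBadTwoLocalLineCount
import Summits.BirchSwinnertonDyer.BirchSwinnertonDyer.Theorems.PrintCf2SplitBadTwoLocalDepthOfGenerator
import Literature.NumberTheory.EllipticCurves.PadicPointsFiniteIndexProofs
import HarnessLib

/-!
# Crux `PrintCf2.SplitBadTwoRankOneOfFacts` (stmt-BirchSwinnertonDyer-20368), road α v10.3, S3c bottom value, factor (F3):
# THE POINT PART OF THE DUAL-SIDE LOCAL IMAGE AT `v`, IN `W(ℚ₂)`-CURRENCY (frame instantiation of `…LocalLineCount`)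

Cell `bsd-print-cf2`, width seat `bsd-line-cf2-p1-w2` g11; `--supports stmt-BirchSwinnertonDyer-20368` (helper, Theses-free).
HONEST FRAMING: nothing here closes a crux or a stub; BSD is not proved by any of this; no summit statement is proved by this seat.
No definition, no named fact, no `sorry`, no kit. beyond-print theorem: no (bookkeeping).

WHAT. On an S3c frame (`d` squarefree, `d ≢ 1 (4)`, `W` globally minimal with `C • W = E^{(d)}`, `P ∈ W(ℚ)`, `c₀ ≠ 0`,
`‖log_Ŵ(z(c₀P₂))/c₀‖ = 2^{−ℓ}`, `P₂ = toPadicPoint 2 P ∈ W(ℚ₂)`), the finite-level Poitou–Tate count of (F3) (-w4 g9 p675312 /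
p675947, -w5 g3 p674907) needs the order of the image of the Mordell–Weil line `ℤ·P₂ + C` in `W(ℚ₂) ⧸ (2^N W(ℚ₂) + W_t)` for a
`2`-power torsion subgroup `W_t` (the frame's `W*(K_v)`, transported along `K_v ≅ ℚ₂`) and a `2`-power torsion subgroup `C` with
`C ⊓ W_t = ⊥` (the frame's `W*′(K)`):
* **`natCard_map_zmultiples_toPadicPoint_sup_eq`** — there is `N₀` such that for all `N ≥ N₀` that image has EXACTLY
  `2^{N − D} · #C` elements, `D := ℓ.toNat − [d ≡ 3 (mod 8)]` (the depth of `P₂`, -w6 g3 p675150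
  `DyadicTorsion.exists_pow_smul_add_torsion_iff_of_frame'`); with `#C = #W*′(K) = 2` this is `#A_N^{pts} = 2^{N − ℓ + [d ≡ 3 (8)] + 1}`;
* `zsmul_toPadicPoint_mem_iff` — for `N ≥ N₀`: `m • P₂ ∈ 2^N W(ℚ₂) + W_t ⟺ 2^{N − D} ∣ m` (order of the class of `P₂`).
Inputs by name: Silverman VII.6.3 for `ℚ₂` (`exists_finiteIndex_addEquiv_padicInt_holds`, PROVED in the tree), my `LocalLineCount`
(p676822), -w6 g3's depth. The threshold `N₀ = D + a` uses the `2`-part `2^a` of an annihilator of `W(ℚ₂)_tors` (`exists_torsion_annihilator`).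

References: J. H. Silverman, *AEC* 2nd ed. (2009), Prop. VII.6.3, Thm. IV.6.4 [SilvermanAEC2009]; A. Agboola, Compositio 143 (2007)
§6 Prop. 6.10–6.11 [Agboola2007]; J. S. Milne, *ADT* (2006) I Thm. 4.10 [MilneADT2006].
-/

noncomputable section

open scoped Classical

set_option linter.dupNamespace false -- `Summit.BirchSwinnertonDyer.BirchSwinnertonDyer` (summit = problem) is the tree's layout
set_option autoImplicit false

namespace Summit.BirchSwinnertonDyer.BirchSwinnertonDyer.Theorems.PrintCf2.LocalLineCount

open WeierstrassCurve Literature.NumberTheory.EllipticCurves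
open Summit.BirchSwinnertonDyer.BirchSwinnertonDyer.Theorems.PrintCf2.DyadicTorsion

/-- A `2`-power torsion element killed by `2^a · b` with `b` odd is killed by `2^a`. [folklore] -/
theorem pow_nsmul_eq_zero_of_annihilator {G : Type*} [AddCommGroup G] {a b : ℕ} (hb : ¬ 2 ∣ b) {w : G}
    (hk : ∃ k : ℕ, 2 ^ k • w = 0) (hab : (2 ^ a * b) • w = 0) : 2 ^ a • w = 0 := by
  haveI : Fact (Nat.Prime 2) := ⟨Nat.prime_two⟩
  obtain ⟨k, hkw⟩ := hk
  refine eq_zero_of_pow_nsmul_of_nsmul (p := 2) (a := k) hb ?_ ?_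
  · rw [smul_comm, hkw, smul_zero]
  · rw [← mul_nsmul', mul_comm, hab]

/-- **THE POINT PART OF THE DUAL-SIDE LOCAL IMAGE OF (F3), `W(ℚ₂)`-currency.** On the S3c frame (binders of -w6 g3's depth theorem):
there is `N₀` such that for every `N ≥ N₀`, every `2`-power torsion subgroups `W_t, C ≤ W(ℚ₂)` with `C ⊓ W_t = ⊥`, and `K = 2^N W(ℚ₂) + W_t`
(given elementwise), the image of `ℤ·P₂ + C` in `W(ℚ₂) ⧸ K` has exactly **`2^{N − (ℓ.toNat − [d ≡ 3 (8)])} · #C`** elements.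
[cite: SilvermanAEC2009, Prop. VII.6.3] [cite: Agboola2007, §6 Prop. 6.10–6.11] -/
theorem natCard_map_zmultiples_toPadicPoint_sup_eq {d : ℤ} (hd : d ≠ 0) (hsq : Squarefree d) (hd4 : d % 4 ≠ 1)
    (W : WeierstrassCurve ℚ) [W.IsElliptic] [W.IsGloballyMinimal] {C : VariableChange ℚ}
    (hC : C • W = cm7.quadraticTwist (d : ℚ)) {P : W.toAffine.Point} {c₀ : ℕ} {ℓ : ℤ} (hc₀ : c₀ ≠ 0)
    (hker : (W.baseChange ℚ_[2]).IsInReductionKernel (c₀ • W.toPadicPoint 2 P))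
    (hℓ : ‖(W.baseChange ℚ_[2]).padicLogPoint (c₀ • W.toPadicPoint 2 P) / (c₀ : ℚ_[2])‖ = (2 : ℝ) ^ (-ℓ)) :
    ∃ N₀ : ℕ, ∀ N : ℕ, N₀ ≤ N →
      ∀ (Wt Ct K : AddSubgroup (W.baseChange ℚ_[2]).toAffine.Point),
        (∀ w ∈ Wt, ∃ k : ℕ, 2 ^ k • w = 0) → (∀ c ∈ Ct, ∃ k : ℕ, 2 ^ k • c = 0) → Disjoint Ct Wt →
        (∀ x, x ∈ K ↔ ∃ y w : (W.baseChange ℚ_[2]).toAffine.Point, w ∈ Wt ∧ 2 ^ N • y + w = x) →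
        Nat.card ↥((AddSubgroup.zmultiples (W.toPadicPoint 2 P) ⊔ Ct).map (QuotientAddGroup.mk' K)) =
          2 ^ (N - (ℓ.toNat - (if d % 8 = 3 then 1 else 0))) * Nat.card Ct := by
  haveI : Fact (Nat.Prime 2) := ⟨Nat.prime_two⟩
  obtain ⟨U, hU, ⟨e⟩⟩ := exists_finiteIndex_addEquiv_padicInt_holds 2 (W.baseChange ℚ_[2])
  haveI := hU
  obtain ⟨a, b, hb, htors⟩ := exists_torsion_annihilator U e
  set D : ℕ := ℓ.toNat - (if d % 8 = 3 then 1 else 0) with hDdef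
  have hD : ∃ y T : (W.baseChange ℚ_[2]).toAffine.Point, IsOfFinAddOrder T ∧ 2 ^ D • y + T = W.toPadicPoint 2 P :=
    (exists_pow_smul_add_torsion_iff_of_frame' hd hsq hd4 W hC hc₀ hker hℓ D).mpr le_rfl
  have hD' : ¬ ∃ y T : (W.baseChange ℚ_[2]).toAffine.Point, IsOfFinAddOrder T ∧ 2 ^ (D + 1) • y + T = W.toPadicPoint 2 P :=
    fun h ↦ absurd ((exists_pow_smul_add_torsion_iff_of_frame' hd hsq hd4 W hC hc₀ hker hℓ (D + 1)).mp h) (by omega)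
  refine ⟨D + a, fun N hN Wt Ct K hWt hCt hdisj hK ↦ ?_⟩
  have hW2 : ∀ w ∈ Wt, 2 ^ a • w = 0 := fun w hw ↦ by
    obtain ⟨k, hk⟩ := hWt w hw
    exact pow_nsmul_eq_zero_of_annihilator hb ⟨k, hk⟩
      (htors w (isOfFinAddOrder_iff_nsmul_eq_zero.mpr ⟨2 ^ k, Nat.pos_of_ne_zero (pow_ne_zero _ two_ne_zero), hk⟩))
  have hC2 : ∀ c ∈ Ct, 2 ^ a • c = 0 := fun c hc ↦ by
    obtain ⟨k, hk⟩ := hCt c hc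
    exact pow_nsmul_eq_zero_of_annihilator hb ⟨k, hk⟩
      (htors c (isOfFinAddOrder_iff_nsmul_eq_zero.mpr ⟨2 ^ k, Nat.pos_of_ne_zero (pow_ne_zero _ two_ne_zero), hk⟩))
  exact natCard_map_zmultiples_sup_eq U e hb htors hN hD hD' Wt Ct K hW2 hC2 hdisj hK

/-- **Order of the class of `P₂` modulo `2^N W(ℚ₂) + W_t`** on the S3c frame: there is `N₀` such that for `N ≥ N₀` and every torsion
subgroup `W_t` with `K = 2^N W(ℚ₂) + W_t`: `m • P₂ ∈ K ⟺ 2^{N − (ℓ.toNat − [d ≡ 3 (8)])} ∣ m`.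
[cite: SilvermanAEC2009, Prop. VII.6.3] -/
theorem zsmul_toPadicPoint_mem_iff {d : ℤ} (hd : d ≠ 0) (hsq : Squarefree d) (hd4 : d % 4 ≠ 1)
    (W : WeierstrassCurve ℚ) [W.IsElliptic] [W.IsGloballyMinimal] {C : VariableChange ℚ}
    (hC : C • W = cm7.quadraticTwist (d : ℚ)) {P : W.toAffine.Point} {c₀ : ℕ} {ℓ : ℤ} (hc₀ : c₀ ≠ 0)
    (hker : (W.baseChange ℚ_[2]).IsInReductionKernel (c₀ • W.toPadicPoint 2 P))
    (hℓ : ‖(W.baseChange ℚ_[2]).padicLogPoint (c₀ • W.toPadicPoint 2 P) / (c₀ : ℚ_[2])‖ = (2 : ℝ) ^ (-ℓ)) :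
    ∃ N₀ : ℕ, ∀ N : ℕ, N₀ ≤ N →
      ∀ (Wt K : AddSubgroup (W.baseChange ℚ_[2]).toAffine.Point), (∀ w ∈ Wt, IsOfFinAddOrder w) →
        (∀ x, x ∈ K ↔ ∃ y w : (W.baseChange ℚ_[2]).toAffine.Point, w ∈ Wt ∧ 2 ^ N • y + w = x) →
        ∀ m : ℤ, m • W.toPadicPoint 2 P ∈ K ↔ ((2 : ℤ) ^ (N - (ℓ.toNat - (if d % 8 = 3 then 1 else 0)))) ∣ m := by
  haveI : Fact (Nat.Prime 2) := ⟨Nat.prime_two⟩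
  obtain ⟨U, hU, ⟨e⟩⟩ := exists_finiteIndex_addEquiv_padicInt_holds 2 (W.baseChange ℚ_[2])
  haveI := hU
  obtain ⟨a, b, hb, htors⟩ := exists_torsion_annihilator U e
  set D : ℕ := ℓ.toNat - (if d % 8 = 3 then 1 else 0) with hDdef
  have hD : ∃ y T : (W.baseChange ℚ_[2]).toAffine.Point, IsOfFinAddOrder T ∧ 2 ^ D • y + T = W.toPadicPoint 2 P :=
    (exists_pow_smul_add_torsion_iff_of_frame' hd hsq hd4 W hC hc₀ hker hℓ D).mpr le_rfl
  have hD' : ¬ ∃ y T : (W.baseChange ℚ_[2]).toAffine.Point, IsOfFinAddOrder T ∧ 2 ^ (D + 1) • y + T = W.toPadicPoint 2 P :=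
    fun h ↦ absurd ((exists_pow_smul_add_torsion_iff_of_frame' hd hsq hd4 W hC hc₀ hker hℓ (D + 1)).mp h) (by omega)
  refine ⟨D + a, fun N hN Wt K hWt hK m ↦ ?_⟩
  have h := zsmul_mem_iff_of_depth U e hb htors hN hD hD' Wt K hWt hK m
  exact_mod_cast h

end Summit.BirchSwinnertonDyer.BirchSwinnertonDyer.Theorems.PrintCf2.LocalLineCount

end
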